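import Literature.IUT.HodgeArakelov.EtaleThetaDataOfSettingInversion
import Literature.IUT.HodgeArakelov.EtaleThetaDataRootTransport
import Literature.IUT.HodgeArakelov.ThetaKummerAutMap
import Literature.AnabelianGeometry.EtaleTheta.ThetaKummerTranslates

/-!
# [IUTchII] Prop 2.2 (ii)′ at the MODEL — END-TO-END assembly: the closing theorem whose residual is the
# inversion datum of [EtTh] + the FUNCTION-level [EtTh] Prop. 1.4 inputs (seventh proof-only companion)

Proof-only companion (abc-iut cell, D-0067 wave 4, cone of [IUTchIII] Cor. 3.12; DAG node **IUTchII:Prop2.2(ii)**;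
no definitions, no `Prop`-valued facts; seat abc-iut-w4-d010, gen 2 — the assembler of the d010 lineage).
S. Mochizuki, *Inter-universal Teichmüller theory II*, kurims manuscript (Dec. 2020) §2, Prop. 2.2 (ii) p. 66
(claim key `Mochizuki2012`, DISPUTED, D-0012): «The functorial group-theoretic algorithms
`Π_v ↦ θ(Π_v) ⊆ ∞θ(Π_v) ⊆ lim_J H¹(Π_Ÿ(Π_v)∣_J, (l·Δ_Θ)(Π_v))` of Proposition 1.4 …, together with the condition of
invariance with respect to `ι` [cf. [EtTh], Proposition 1.4, (ii); the proof of [EtTh], Theorem 1.6, (iii)],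
determines a specific `μ_{2l}`- (respectively, `μ (= M^μ_TM(Π_v))`-) orbit `θ^ι(Π_v) ⊆ θ(Π_v)` (respectively,
`∞θ^ι(Π_v) ⊆ ∞θ(Π_v)`) within the unique `{(l·ℤ) × μ_{2l}}`- (respectively, each `{(l·ℤ) × μ}`-) orbit contained in
the set `θ(Π_v)` (respectively, `∞θ(Π_v)`)» (this file treats the `θ` branch only); [EtTh] (S. Mochizuki, Publ. RIMS **45** (2009), refereed) Prop. 1.4 (i)–(iii) pp. 20–22
(«`Θ̈(Ü) = −Θ̈(Ü⁻¹)`; `Θ̈(−Ü) = −Θ̈(Ü)`; `Θ̈(q^{a/2}Ü) = (−1)^a q^{−a²/2} Ü^{−2a} Θ̈(Ü)`»), Thm. 1.6 (ii) p. 24,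
Def. 2.5 (i) p. 39, Prop. 2.2 (i) p. 37 (the inversion `ι` acts on `Δ_Θ` with eigenvalue `1` — print: «with
eigenvalues −1 and 1, respectively»; the gloss «by `+1`» used below is ours), Def. 2.7 p. 41.

WHAT THIS FILE DOES. Pure application — it COMPOSES the pieces landed tonight on GAP row G-w4d010-2:
* the d010 closing theorem `prop22_ii'_model` (p414140) in abc-iut-w5-d072's form
  `EtaleThetaDataOfSetting.prop22_ii'_model_of_inversion` (p416287: (R1) — the pair `(α, β) :=
  (inversionAlpha C ι hι, c.thetaIso)` from an automorphism `ι` of `Π^tp_X` stabilising `Π^tp_X̲̲`, a theta companion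
  `c` ([EtTh] Thm. 1.6 (ii), abc-iut-L2-t1) and the `ℤ`-reversal `hZ`; `ρ`, `ρlim`, the square, `hρT`, `hH`,
  `hφ`, `hA`, `hαγ` constructed there);
* abc-iut-L2-t8's §2 transports `hsign_of_etaDd_sign` / `hfree_of_etaDd_free` / `not_isOfFinOrder_translate_of_etaDd`
  (p415404) and `hroot_of_coeffChange_root` (p416087, the ι-shape: `hroot` from the `Δ_Θ`-level statement);
* abc-iut-w4-d014's `coeffChange_h1TopAut` (p415311);
* abc-iut-w5-d125's §1 suppliers `exists_sq_one_conj_etaDd_of_deck` (p414885, deck form of «`Θ̈(−Ü) = −Θ̈(Ü)`»),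
  `not_isOfFinOrder_comap_translate_of_kummer` (p415355, the translates) and `autMap_comap_etaDd_eq_conj`
  (p416114, «`Θ̈(Ü) = −Θ̈(Ü⁻¹)`» for the pair);
into TWO closing theorems at `D := etaleThetaDataOfSetting'` (abc-iut-L6-t1):
* `prop22_ii'_model_of_inversion_of_classLevel` — residual = the ι-datum `(ι, hι, c, hZ, δ/hιι, hβ)` + the three
  `Δ_Θ`-CLASS-level [EtTh] Prop. 1.4 statements on `η̈^Θ = E.etaDd` (ε-sign, ι-translate, non-torsion of the
  `γ`-translates) — NO `l·Δ_Θ`-root-level hypothesis left;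
* **`prop22_ii'_model_of_thetaKummer`** — residual = the ι-datum + abc-iut-w5-d125's FUNCTION-level inputs on
  abc-iut-L2-t12's `ThetaKummerInput T` (`E.etaDd = T.kummerTheta`, `hdeck`, the pull-back `ιFn` of functions along
  `ι` with «`ιFn Θ̈ = const(−1)·Θ̈`», the translate identity with the coordinate `Ü`, `Λ(Fn) ≅ Δ_Θ`, a ℚ-valued
  order function) — NO class-level hypothesis left. The end-to-end junction of the (R2)-hsign/(R3)-hfree half was
  probed by abc-iut-w5-d121 (STATUS 01:37:41Z); this file is the landed form, with hroot and (R1) included.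
Small bookkeeping lemmas (this file): `inversionAlpha_apply_apply_eq_conj` (α² = conj δ from ι² = conj δ on
`Π^tp_X̲̲`), `smul_inversionAlpha` (the `α`-twisted equivariance binder in ι-form).

HONEST RESIDUAL (unchanged in substance from D-G-w4d010-2f, now kernel-pinned as binders of ONE theorem): the
inversion `ι ∈ Aut_top(Π^tp_X)` with `ι(Π^tp_X̲̲) = Π^tp_X̲̲`, its theta companion, `toZ (ι γ) = (toZ γ)⁻¹`, `ι² = conj δ`
on `Π^tp_X̲̲` (`δ ∈ Π^tp_X̲̲`), `ι ≡ +1` on `Δ_Θ/l·Δ_Θ`; and the function-level [EtTh] Prop. 1.4 package (abc-iut-L2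
vocabulary; `Fn` has no carrier, so these are hypotheses on t12's data exactly like `theta_mem`). No new Prop fact,
no definition. [claim: Mochizuki2012, status: disputed] Nothing here takes a side on [IUTchIII] Cor. 3.12;
typed ≠ proved.
-/

namespace Literature.IUT.HodgeArakelov

open Literature.AnabelianGeometry.EtaleTheta (ContH1 ThetaSetting RootSystem cyclotome)
open Literature.AnabelianGeometry.EtaleTheta
open EtaleThetaDataOfSetting CohomologySystemOfContH1

noncomputable section

namespace EtaleThetaDataOfSetting

variable {p : ℕ} [Fact p.Prime] {D : Literature.AnabelianGeometry.EtaleTheta.ThetaSetting p}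
  {E : D.EtaleThetaData} {l : ℕ} (C : E.DoubleUnderline l)

/-! ## §0. Bookkeeping: the ι-datum in the shapes the transports consume -/

section Inversion

variable (ι : D.PiTemp ≃ₜ* D.PiTemp) (hι : C.Huu.map ι.toMulEquiv.toMonoidHom = C.Huu)

/-- `α² = conj δ` on `Π := Π^tp_X̲̲` for `α := ι|Π^tp_X̲̲`, from `ι (ι x) = δ x δ⁻¹` on `Π^tp_X̲̲` ([IUTchII] Rmk. 1.4.1 (ii)
p. 28: `ι_X̲̲` has order two as a `Δ`-OUTER automorphism — `PointedInversion.iota_sq_inner`).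
[cite: Mochizuki2012, Rmk 1.4.1 (ii) p.28] -/
theorem inversionAlpha_apply_apply_eq_conj (δ : Pi C)
    (hιι : ∀ x : Pi C, ι (ι (x : D.PiTemp)) = (δ : D.PiTemp) * (x : D.PiTemp) * (δ : D.PiTemp)⁻¹) (x : Pi C) :
    inversionAlpha C ι hι (inversionAlpha C ι hι x) = δ * x * δ⁻¹ := by
  apply Subtype.ext
  rw [coe_inversionAlpha, coe_inversionAlpha, hιι]
  rfl

/-- The `α`-twisted equivariance of a pull-back of functions `ιFn` along `ι` (abc-iut-w5-d125's binder `hιFn` of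
`autMap_comap_etaDd_eq_conj`), in ι-form: `ιFn (g • f) = ι(g) • ιFn f` for `g ∈ Π^tp_X̲̲`.
[cite: MochizukiEtTh2009, Prop 1.4 (ii) p.22] -/
theorem smul_inversionAlpha {F : Type} [CommGroup F] [MulDistribMulAction D.PiTemp F] (ιFn : F →* F)
    (hιFn : ∀ (g : Pi C) (f : F), ιFn ((g : D.PiTemp) • f) = ι (g : D.PiTemp) • ιFn f) (g : Pi C) (f : F) :
    ιFn ((g : D.PiTemp) • f) = ((inversionAlpha C ι hι g : Pi C) : D.PiTemp) • ιFn f := by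
  rw [coe_inversionAlpha]
  exact hιFn g f

variable (c : ThetaSetting.ThetaCompanion ι)

/-- A theta companion maps `Δ_Θ` into `Δ_Θ` (`c.apply_mem`, [EtTh] Thm. 1.6 (ii)) — the `→` form of the coefficient
hypothesis at the BIG coefficients `A' = Δ_Θ`. [cite: MochizukiEtTh2009, Thm 1.6 (ii) p.24] -/
theorem thetaCompanion_mem_deltaTheta (a : D.GtpTheta) (ha : a ∈ D.DeltaTheta) : c.thetaIso a ∈ D.DeltaTheta :=
  c.apply_mem ⟨a, ha⟩

/-! ## §1. The closing theorem with (R2)/(R3) at the `Δ_Θ`-CLASS level (no `l·Δ_Θ`-root-level input) -/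

/-- **IUTchII:Prop2.2(ii)′ at the model `Π_v := Π^tp_X̲̲`, from the [EtTh] inversion datum and the `Δ_Θ`-CLASS-level
[EtTh] Prop. 1.4 statements** (kurims p. 66: «determines a specific `μ_{2l}`- … orbit `θ^ι(Π_v) ⊆ θ(Π_v)` …
within the unique `{(l·ℤ) × μ_{2l}}`- … orbit», `θ` branch). INPUTS: the model data of abc-iut-L6-t1 (`C`, `hC`, `hS`, (H1) `hchar`, `S`, `eS`,
`hl`) and a Prop. 2.2 (i) datum `Dec`; (R1) an automorphism `ι` of `Π^tp_X` with `ι(Π^tp_X̲̲) = Π^tp_X̲̲`, a theta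
companion `c` ([EtTh] Thm. 1.6 (ii)), `toZ (ι γ) = (toZ γ)⁻¹` at a `toLZ`-generator `γ` ([IUTchII] Rmk. 2.1.1 (i)),
`ι² = conj δ` on `Π^tp_X̲̲` (Rmk. 1.4.1 (ii)), `ι ≡ +1` on `Δ_Θ/l·Δ_Θ` ([EtTh] Prop. 2.2 (i)); a deck element
`ε ∈ Π^tp_X̲̲ ∩ (Π^tp_Y ∖ Π^tp_Ÿ)`; (R2)/(R3) at the `Δ_Θ`-class level on `η̈^Θ = E.etaDd`: the ε-sign
(«`Θ̈(−Ü) = −Θ̈(Ü)`»: `ε·η̈ = η̈·κ₁`, `κ₁² = 1`), the ι-translate («`Θ̈(Ü) = −Θ̈(Ü⁻¹)`»: the pair `(ι|, c.thetaIso)`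
carries the pull-back of `η̈` to its `ε`-conjugate), and the non-torsion of the `γ`-translates («`Θ̈(q^{a/2}Ü) = …`»).
OUTPUT: the repaired `Prop22_ii' Dec`. PROOF: `hsign_of_etaDd_sign`, `hfree_of_etaDd_free`,
`not_isOfFinOrder_translate_of_etaDd` (abc-iut-L2-t8), `hroot_of_coeffChange_root` (abc-iut-L2-t8) after
`coeffChange_h1TopAut` (abc-iut-w4-d014) + `coeffChange_rootLiftClass_eq_comap`, then abc-iut-w5-d072's
`prop22_ii'_model_of_inversion`. [claim: Mochizuki2012, status: disputed] (IUTchII §2 Prop 2.2 (ii), kurims pp.65-67) -/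
theorem prop22_ii'_model_of_inversion_of_classLevel [hN : (PiYdd C).Normal] [hYN : D.GtpYdd.Normal] (hC : D.Compat) (hS : D.Sec2Hyps)
    (hchar : PiYddCharacteristic C) (S : BadPlaceSetting.{0}) (eS : (Pi C) ≃ₜ* S.PiX) (hl : S.l = l)
    {T₀ : TemperedCoverings S (Pi C)}
    (Dec : SubgraphDecomposition S T₀ (etaleThetaDataOfSetting' C hC hS hchar S.toThetaSetting eS hl))
    -- (R1) the inversion datum
    (γ ε : Pi C) (hγ : C.toLZ γ = Multiplicative.ofAdd 1) (hε₁ : (ε : D.PiTemp) ∈ D.GtpY)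
    (hε₂ : (ε : D.PiTemp) ∉ D.GtpYdd) (hZ : D.toZ (ι (γ : D.PiTemp)) = (D.toZ (γ : D.PiTemp))⁻¹)
    (δ : Pi C) (hιι : ∀ x : Pi C, ι (ι (x : D.PiTemp)) = (δ : D.PiTemp) * (x : D.PiTemp) * (δ : D.PiTemp)⁻¹)
    (hβ : ∀ a : D.GtpTheta, a ∈ D.DeltaTheta → c.thetaIso a * a⁻¹ ∈ D.lDeltaTheta l)
    -- (R2)/(R3) [EtTh] Prop. 1.4 at the Δ_Θ-class level on `η̈^Θ`
    (h14sign : ∃ κ₁ : ContH1 D.toTheta D.DeltaTheta D.GtpYdd, κ₁ ^ 2 = 1 ∧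
      ContH1.conj D.toTheta D.DeltaTheta (ε : D.PiTemp) E.etaDd = E.etaDd * κ₁)
    (h14iota : ContH1Aut.autMap (phi C) D.DeltaTheta (inversionAlpha C ι hι) c.thetaIso
        (thetaCompanion_phi C ι hι c) (thetaCompanion_mem_deltaTheta ι c)
        (symm_mem_inf_top (PiYdd C) (inversionAlpha C ι hι) (mem_PiYdd_iff_of_piYddCharacteristic C hchar _))
        (ContH1.comap D.toTheta D.DeltaTheta C.Huu.subtype continuous_subtype_val
          (map_subtype_piYdd_inf_le_GtpYdd C ⊤) E.etaDd) =
      ContH1.conj (phi C) D.DeltaTheta ε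
        (ContH1.comap D.toTheta D.DeltaTheta C.Huu.subtype continuous_subtype_val
          (map_subtype_piYdd_inf_le_GtpYdd C ⊤) E.etaDd))
    (h14free : ∀ k : ℤ, k ≠ 0 → ¬ IsOfFinOrder
      (ContH1.comap D.toTheta D.DeltaTheta C.Huu.subtype continuous_subtype_val
        (map_subtype_piYdd_inf_le_GtpYdd C ⊤)
        (ContH1.conj D.toTheta D.DeltaTheta ((γ : D.PiTemp) ^ k) E.etaDd * E.etaDd⁻¹))) :
    Prop22_ii' Dec := by
  -- the pair and its bookkeeping, under the NAMES of abc-iut-w5-d072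
  have hφ := thetaCompanion_phi C ι hι c
  have hA : ∀ a : D.GtpTheta, a ∈ D.lDeltaTheta l → c.thetaIso a ∈ D.lDeltaTheta l :=
    fun a ha => (mem_lDeltaTheta_iff_thetaCompanion ι c l a).mp ha
  have hH := mem_PiYdd_iff_of_piYddCharacteristic C hchar (inversionAlpha C ι hι)
  -- (R2) hsign and (R3) hfree / hfreeK at the root-class level (abc-iut-L2-t8's transports)
  have hsign := hsign_of_etaDd_sign C hS ε hε₁ h14sign
  have hfreeK := not_isOfFinOrder_translate_of_etaDd C γ h14free
  have hfree := hfree_of_etaDd_free C γ h14free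
  -- (R2) hroot: the Δ_Θ-image of `T η̲̈` is the `ε`-conjugate of the Δ_Θ-image of `η̲̈`
  have hΔ : ∃ τ₀ : Pi C, (τ₀ : D.PiTemp) ∈ D.GtpY ∧
      ContH1.coeffChange (phi C) (D.lDeltaTheta_le l) (PiYdd C ⊓ ⊤)
          (h1TopAut (phi C) (D.lDeltaTheta l) (PiYdd C) (inversionAlpha C ι hι) c.thetaIso hφ hA hH
            (rootLiftClass C)) =
        ContH1.conj (phi C) D.DeltaTheta τ₀
          (ContH1.coeffChange (phi C) (D.lDeltaTheta_le l) (PiYdd C ⊓ ⊤) (rootLiftClass C)) := by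
    refine ⟨ε, hε₁, ?_⟩
    rw [coeffChange_h1TopAut (phi C) (D.lDeltaTheta_le l) (PiYdd C) (inversionAlpha C ι hι) c.thetaIso hφ hA hH
        (thetaCompanion_mem_deltaTheta ι c), coeffChange_rootLiftClass_eq_comap, h1TopAut_apply]
    exact h14iota
  have hroot := hroot_of_coeffChange_root C (inversionAlpha C ι hι) c.thetaIso hφ hA hH hS γ ε hγ hε₁ hε₂ hsign
    hfreeK δ (inversionAlpha_apply_apply_eq_conj C ι hι δ hιι) hβ hΔ
  exact prop22_ii'_model_of_inversion C ι hι c hC hS hchar S eS hl Dec γ ε hγ hε₁ hε₂ hZ hsign hroot hfree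

end Inversion

/-! ## §2. The END-TO-END closing theorem: (R2)/(R3) from the FUNCTION-level [EtTh] Prop. 1.4 package -/

/-- **IUTchII:Prop2.2(ii)′ at the model `Π_v := Π^tp_X̲̲` — END-TO-END** (kurims p. 66): the repaired `Prop22_ii' Dec`
HOLDS at `D := etaleThetaDataOfSetting'` (abc-iut-L6-t1) for every Prop. 2.2 (i) datum `Dec`, GIVEN EXACTLY:
(model) `C`, `hC`, `hS`, (H1) `hchar`, `S`, `eS`, `hl`;
(R1, the pointed inversion, [IUTchII] Rmk. 1.4.1 (ii) / Rmk. 2.1.1 (i), [EtTh] Def. 2.5 (i), Thm. 1.6 (ii),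
Prop. 2.2 (i)) an automorphism `ι` of `Π^tp_X` with `ι(Π^tp_X̲̲) = Π^tp_X̲̲`, a theta companion `c`, the `ℤ`-reversal
`toZ (ι γ) = (toZ γ)⁻¹` at a `toLZ`-generator `γ ∈ Π^tp_X̲̲`, `ι² = conj δ` on `Π^tp_X̲̲`, `ι ≡ +1` on `Δ_Θ/l·Δ_Θ`, and a
deck element `ε ∈ Π^tp_X̲̲ ∩ (Π^tp_Y ∖ Π^tp_Ÿ)`;
(R2)(R3) at the FUNCTION level, on abc-iut-L2-t12's `ThetaKummerInput T` (abc-iut-w5-d125's package): `η̈^Θ = κ(Θ̈)`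
(`hη`), the deck identity «`Θ̈(−Ü) = −Θ̈(Ü)`» (`hdeck`), a pull-back of functions `ιFn` along `ι` (`α`-twisted
equivariant, compatible with `Λ(Fn) → Δ_Θ` under `c.thetaIso`) with «`ιFn Θ̈ = const(−1)·Θ̈`» (= «`Θ̈(Ü) = −Θ̈(Ü⁻¹)`»),
the coordinate `Ü ∈ Fn^{Π^tp_Ÿ}` with compatible roots of its powers and the translate identity
«`γᵏ • Θ̈ = c_k · Ü^{e k} · Θ̈`», `e ≠ 0` (= «`Θ̈(q^{a/2}Ü) = (−1)^a q^{−a²/2} Ü^{−2a} Θ̈(Ü)`»), `Λ(Fn) → Δ_Θ` bijective,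
and a ℚ-valued order function killing constants, nonzero on `Ü`, with bounded denominators on `Fn^{Π^tp_Ÿ̲̲}`.
NOTHING at the class level remains. PROOF: `prop22_ii'_model_of_inversion_of_classLevel` with the three class-level
inputs supplied by abc-iut-w5-d125's `exists_sq_one_conj_etaDd_of_deck` (p414885), `autMap_comap_etaDd_eq_conj`
(p416114) and `not_isOfFinOrder_comap_translate_of_kummer` (p415355).
[claim: Mochizuki2012, status: disputed] (IUTchII §2 Prop 2.2 (ii), kurims pp.65-67) -/
theorem prop22_ii'_model_of_thetaKummer [hN : (PiYdd C).Normal] [hYN : D.GtpYdd.Normal] (hC : D.Compat) (hS : D.Sec2Hyps)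
    (hchar : PiYddCharacteristic C) (S : BadPlaceSetting.{0}) (eS : (Pi C) ≃ₜ* S.PiX) (hl : S.l = l)
    {T₀ : TemperedCoverings S (Pi C)}
    (Dec : SubgraphDecomposition S T₀ (etaleThetaDataOfSetting' C hC hS hchar S.toThetaSetting eS hl))
    -- (R1) the inversion datum
    (ι : D.PiTemp ≃ₜ* D.PiTemp) (hι : C.Huu.map ι.toMulEquiv.toMonoidHom = C.Huu)
    (c : ThetaSetting.ThetaCompanion ι)
    (γ ε : Pi C) (hγ : C.toLZ γ = Multiplicative.ofAdd 1) (hε₁ : (ε : D.PiTemp) ∈ D.GtpY)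
    (hε₂ : (ε : D.PiTemp) ∉ D.GtpYdd) (hZ : D.toZ (ι (γ : D.PiTemp)) = (D.toZ (γ : D.PiTemp))⁻¹)
    (δ : Pi C) (hιι : ∀ x : Pi C, ι (ι (x : D.PiTemp)) = (δ : D.PiTemp) * (x : D.PiTemp) * (δ : D.PiTemp)⁻¹)
    (hβ : ∀ a : D.GtpTheta, a ∈ D.DeltaTheta → c.thetaIso a * a⁻¹ ∈ D.lDeltaTheta l)
    -- (R2)(R3) the FUNCTION-level [EtTh] Prop. 1.4 package on t12's `ThetaKummerInput`
    (T : D.ThetaKummerInput) (hη : E.etaDd = T.kummerTheta)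
    (hdeck : ∀ e' : D.PiTemp, e' ∈ D.GtpY → e' ∉ D.GtpYdd → e' • T.theta = T.const (-1) * T.theta)
    (ιFn : T.Fn →* T.Fn)
    (hιFn : ∀ (g : Pi C) (f : T.Fn), ιFn ((g : D.PiTemp) • f) = ι (g : D.PiTemp) • ιFn f)
    (hΛ : ∀ ζ : cyclotome T.Fn, ContH1Aut.coeffMap D.DeltaTheta c.thetaIso (thetaCompanion_mem_deltaTheta ι c)
        (T.coeff.hom ζ) = T.coeff.hom (cyclotome.map ιFn ζ))
    (hιθ : ιFn T.theta = T.const (-1) * T.theta)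
    {udd : T.Fn} (hu : udd ∈ MulAction.fixedPoints D.GtpYdd T.Fn) (xpow : ∀ m : ℤ, RootSystem (udd ^ m))
    (e : ℤ) (he : e ≠ 0)
    (hpow : ∀ k : ℤ, ∃ ck : (↥D.Kdd)ˣ, ((γ : D.PiTemp) ^ k) • T.theta = T.const ck * udd ^ (e * k) * T.theta)
    (hΛbij : Function.Bijective T.coeff.hom)
    (ord : T.Fn →* Multiplicative ℚ) (hordc : ∀ ck, ord (T.const ck) = 1) (hordu : ord udd ≠ 1)
    {d : ℕ} (hd : 0 < d)
    (hint : ∀ f ∈ MulAction.fixedPoints ((PiYdd C ⊓ ⊤).map C.Huu.subtype) T.Fn,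
      ∃ z : ℤ, Multiplicative.toAdd (ord f) = z / d) :
    Prop22_ii' Dec := by
  refine prop22_ii'_model_of_inversion_of_classLevel C ι hι c hC hS hchar S eS hl Dec γ ε hγ hε₁ hε₂ hZ δ hιι hβ
    (E.exists_sq_one_conj_etaDd_of_deck T hdeck hη hε₁ hε₂) ?_
    (E.not_isOfFinOrder_comap_translate_of_kummer T hη hu xpow (γ : D.PiTemp) e he hpow hΛbij
      (map_subtype_piYdd_inf_le_GtpYdd C ⊤) ord hordc hordu hd hint)
  exact E.autMap_comap_etaDd_eq_conj T hη (map_subtype_piYdd_inf_le_GtpYdd C ⊤) (inversionAlpha C ι hι)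
    c.thetaIso (thetaCompanion_phi C ι hι c) (thetaCompanion_mem_deltaTheta ι c)
    (symm_mem_inf_top (PiYdd C) (inversionAlpha C ι hι) (mem_PiYdd_iff_of_piYddCharacteristic C hchar _))
    ιFn (smul_inversionAlpha C ι hι ιFn hιFn) hΛ hιθ hdeck ε hε₁ hε₂

end EtaleThetaDataOfSetting

end

end Literature.IUT.HodgeArakelov

/-! ## v2 (append-only): the deck-element binder `ε` DISCHARGED — a deck element always exists

The closing theorem `prop22_ii'_model_of_thetaKummer` carries `(ε : Π^tp_X̲̲) (hε₁ : ε ∈ Π^tp_Y) (hε₂ : ε ∉ Π^tp_Ÿ)`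
although `ε` does not occur in its conclusion: it is only the deck transformation through which the function-level
inputs «`Θ̈(−Ü) = −Θ̈(Ü)`» / «`Θ̈(Ü) = −Θ̈(Ü⁻¹)`» are routed. Since `[Π^tp_Y̲̲ : Π^tp_Ÿ̲̲] = 2` (abc-iut-L2-t8's
`relIndex_GtpYdd_inf`, [EtTh] Def. 2.7 p. 41 «`Π^tp_X̲̲/Π^tp_Ÿ̲̲ ≅ (l·ℤ) × μ₂`»), such an `ε` EXISTS — so the binder
is discharged: `exists_deck_element`, `prop22_ii'_model_of_thetaKummer'`. -/

namespace Literature.IUT.HodgeArakelov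

open Literature.AnabelianGeometry.EtaleTheta (ContH1 ThetaSetting RootSystem cyclotome)
open Literature.AnabelianGeometry.EtaleTheta
open EtaleThetaDataOfSetting CohomologySystemOfContH1

noncomputable section

namespace EtaleThetaDataOfSetting

variable {p : ℕ} [Fact p.Prime] {D : Literature.AnabelianGeometry.EtaleTheta.ThetaSetting p}
  {E : D.EtaleThetaData} {l : ℕ} (C : E.DoubleUnderline l)

/-- **A deck element exists**: there is `ε ∈ Π^tp_X̲̲ ∩ Π^tp_Y` with `ε ∉ Π^tp_Ÿ` (the non-trivial deck transformation
of `Ÿ̲̲ → Y̲̲`), because `[Π^tp_Y̲̲ : Π^tp_Ÿ̲̲] = 2 ≠ 1` (abc-iut-L2-t8 `relIndex_GtpYdd_inf`, under `Sec2Hyps`).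
[cite: MochizukiEtTh2009, Def 2.7 p.41] -/
theorem exists_deck_element (hS : D.Sec2Hyps) :
    ∃ ε : Pi C, (ε : D.PiTemp) ∈ D.GtpY ∧ (ε : D.PiTemp) ∉ D.GtpYdd := by
  have h2 : (D.GtpYdd.subgroupOf (C.Huu ⊓ D.GtpY)).index = 2 := C.relIndex_GtpYdd_inf hS
  have hne : D.GtpYdd.subgroupOf (C.Huu ⊓ D.GtpY) ≠ ⊤ := by
    intro htop
    rw [htop, Subgroup.index_top] at h2
    exact absurd h2 (by norm_num)
  obtain ⟨x, hx⟩ : ∃ x : ↥(C.Huu ⊓ D.GtpY), x ∉ D.GtpYdd.subgroupOf (C.Huu ⊓ D.GtpY) := by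
    by_contra h
    push Not at h
    exact hne (eq_top_iff.mpr fun x _ => h x)
  refine ⟨⟨(x : D.PiTemp), (Subgroup.mem_inf.mp x.2).1⟩, (Subgroup.mem_inf.mp x.2).2, ?_⟩
  rwa [Subgroup.mem_subgroupOf] at hx

/-- **IUTchII:Prop2.2(ii)′ at the model — END-TO-END, without the deck-element binder**: as
`prop22_ii'_model_of_thetaKummer`, with `(ε, hε₁, hε₂)` DISCHARGED by `exists_deck_element`. Residual binders:
the model data, (R1) the ι-datum `(ι, hι, c, hZ, δ/hιι, hβ)` with a `toLZ`-generator `γ`, and the FUNCTION-level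
[EtTh] Prop. 1.4 package on t12's `ThetaKummerInput`. [claim: Mochizuki2012, status: disputed]
(IUTchII §2 Prop 2.2 (ii), kurims pp.65-67) -/
theorem prop22_ii'_model_of_thetaKummer' [hN : (PiYdd C).Normal] [hYN : D.GtpYdd.Normal] (hC : D.Compat)
    (hS : D.Sec2Hyps) (hchar : PiYddCharacteristic C) (S : BadPlaceSetting.{0}) (eS : (Pi C) ≃ₜ* S.PiX)
    (hl : S.l = l) {T₀ : TemperedCoverings S (Pi C)}
    (Dec : SubgraphDecomposition S T₀ (etaleThetaDataOfSetting' C hC hS hchar S.toThetaSetting eS hl))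
    -- (R1) the inversion datum
    (ι : D.PiTemp ≃ₜ* D.PiTemp) (hι : C.Huu.map ι.toMulEquiv.toMonoidHom = C.Huu)
    (c : ThetaSetting.ThetaCompanion ι)
    (γ : Pi C) (hγ : C.toLZ γ = Multiplicative.ofAdd 1) (hZ : D.toZ (ι (γ : D.PiTemp)) = (D.toZ (γ : D.PiTemp))⁻¹)
    (δ : Pi C) (hιι : ∀ x : Pi C, ι (ι (x : D.PiTemp)) = (δ : D.PiTemp) * (x : D.PiTemp) * (δ : D.PiTemp)⁻¹)
    (hβ : ∀ a : D.GtpTheta, a ∈ D.DeltaTheta → c.thetaIso a * a⁻¹ ∈ D.lDeltaTheta l)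
    -- (R2)(R3) the FUNCTION-level [EtTh] Prop. 1.4 package on t12's `ThetaKummerInput`
    (T : D.ThetaKummerInput) (hη : E.etaDd = T.kummerTheta)
    (hdeck : ∀ e' : D.PiTemp, e' ∈ D.GtpY → e' ∉ D.GtpYdd → e' • T.theta = T.const (-1) * T.theta)
    (ιFn : T.Fn →* T.Fn)
    (hιFn : ∀ (g : Pi C) (f : T.Fn), ιFn ((g : D.PiTemp) • f) = ι (g : D.PiTemp) • ιFn f)
    (hΛ : ∀ ζ : cyclotome T.Fn, ContH1Aut.coeffMap D.DeltaTheta c.thetaIso (thetaCompanion_mem_deltaTheta ι c)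
        (T.coeff.hom ζ) = T.coeff.hom (cyclotome.map ιFn ζ))
    (hιθ : ιFn T.theta = T.const (-1) * T.theta)
    {udd : T.Fn} (hu : udd ∈ MulAction.fixedPoints D.GtpYdd T.Fn) (xpow : ∀ m : ℤ, RootSystem (udd ^ m))
    (e : ℤ) (he : e ≠ 0)
    (hpow : ∀ k : ℤ, ∃ ck : (↥D.Kdd)ˣ, ((γ : D.PiTemp) ^ k) • T.theta = T.const ck * udd ^ (e * k) * T.theta)
    (hΛbij : Function.Bijective T.coeff.hom)
    (ord : T.Fn →* Multiplicative ℚ) (hordc : ∀ ck, ord (T.const ck) = 1) (hordu : ord udd ≠ 1)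
    {d : ℕ} (hd : 0 < d)
    (hint : ∀ f ∈ MulAction.fixedPoints ((PiYdd C ⊓ ⊤).map C.Huu.subtype) T.Fn,
      ∃ z : ℤ, Multiplicative.toAdd (ord f) = z / d) :
    Prop22_ii' Dec := by
  obtain ⟨ε, hε₁, hε₂⟩ := exists_deck_element C hS
  exact prop22_ii'_model_of_thetaKummer C hC hS hchar S eS hl Dec ι hι c γ ε hγ hε₁ hε₂ hZ δ hιι hβ T hη hdeck
    ιFn hιFn hΛ hιθ hu xpow e he hpow hΛbij ord hordc hordu hd hint

end EtaleThetaDataOfSetting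

end

end Literature.IUT.HodgeArakelov
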